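import Summits.QuantumFields.YangMills.Theorems.UnitScaleTiltProp7TorusGreenGradientDecay
import Summits.QuantumFields.YangMills.Theorems.UnitScaleTiltProp7TorusGreenDictionary
import Summits.QuantumFields.YangMills.Theorems.UnitScaleTiltProp7NearFieldShellSum
import HarnessLib

/-!
# Route `UnitScaleTilt`, crux K1 «MinimiserStabilityRegPr» (stmt-QuantumFields-19200), route-R E′ path (α′), residue (hK), step (A), row (R4) = A2: THE NEAR-FIELD BRICK —
# the gradient of the torus Green function of `(ℤ/Lℤ)³` summed over a sup-norm torus ball of radius `R` is `≤ C·(R + 1)`, UNIFORMLY IN THE PERIOD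
# (`Σ_{dist_∞(z,0) ≤ R} |G̃_L(z+eᵢ) − G̃_L(z)| ≤ C(R+1)`, `2R < L`; and the two-point form `Σ_{dist_∞(z,b) ≤ R} ‖Δ⁻¹(b+eᵢ,z) − Δ⁻¹(b,z)‖ ≤ C(R+1)` for B5's `LapSinv` at `c = 1`)

Cell `ym3-torus`, width seat `ym3-torus-px7` (gen 2), on ★routeR-w3 g5's NAMING 2026-08-28T19:28:35Z «px7: (R4) A2 NEAR-FIELD BRICK — GO» (★★OWNER g28 CONDUCT WORD 2 19:29:03Z
«(R4) = px7 g2»); LOCATE `ym3-torus-px7/g2/LOCATE-HK-HESS3-px7g2.md` §1 (19200 evidence #53) and ★routeR-w3's LOCATE #53 §8 A2.  `--supports stmt-QuantumFields-19200`, count-neutral.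
THEOREMS ONLY (0 `def`, 0 `sorry`).  YM₃ on T³ is a ladder rung (R3), not the Clay problem; nothing here claims the stub, the crux, d = 4 or the gap.

THE POINT.  The kernel bound (hK) `Σ_z|K(b,z)| ≤ c_I·ℓ` of ✓ `…CentreHarmonicInterpKernel.norm_grad_interp_error_le` splits into near field + far field (LOCATE #53 §8 A2∕A3∕A4).
The near field is the Newtonian gradient `∇_bG̃₁(b − z)` summed over `dist_∞(z,b) ≤ R` (`R ≍ 2ℓ`): pointwise `|∇G̃_L(z)|·Σ_μz̃_μ² ≤ C_N` (✓p659194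
`Prop7TorusGreenGradientDecay.torusGreen_grad_mul_dist_sq_le`, d = 3, L-uniform) on the sup-shell of radius `r` gives `≤ C_N∕r²`, the shell has `≤ 54r²` sites, so the ball sum is
`≤ |∇G̃_L(0)| + 54·C_N·R` (✓p658293 `Prop7NearFieldShellSum.sum_box_le_of_shell_decay` on the `Zd 3` window `y ↦ (y_μ mod L)_μ`, injective-free: only `ι z := (z̃_μ)_μ` is used,
`π ∘ ι = id`); the centre term `|G̃_L(eᵢ) − G̃_L(0)|` is bounded UNIFORMLY IN `L` by the same heat-kernel route as ✓p659194 with the Gaussian weight dropped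
(`|∇∏q^L_s| ≤ K(1∨s)⁻² ≤ 4K(1+s)⁻²`, `∫₀^∞ = 4K`; tail `(π∕4)C₀³L⁻²`).  The two-point `LapSinv` form is the dictionary ✓p659572 `LapSinv_one_apply_eq_half_torusGreen`
(`Δ⁻¹(x,z) = ½G̃_L(x − z)`) and the reindexing `z ↦ b − z`.

WHAT IS PROVED (ns `…Theorems.Prop7NearFieldGreenGradientSum`; carrier `TorusSite 3 L = Fin 3 → ZMod L = Tor (fun _ => L)`; `z̃ = valMinAbs`).
* §1 ★ `abs_torusGreen_grad_le` — `∃ C₁, ∀ L ≥ 1, ∀ i, ∀ z, |G̃_L(z+eᵢ) − G̃_L(z)| ≤ C₁` (ALL `z`, incl. `z = 0`; `C₁ = 4K + (π∕4)C₀³`).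
* §2 window letters: `valMinAbs_intCast_of_two_mul_abs_lt` (`2|n| < L ⇒ (n mod L)~ = n`), `sq_le_sum_sq_of_mem_shell` (`r² ≤ Σ_μ y_μ²` on the sup-shell of radius `r`),
  `abs_grad_window_le_of_mem_shell` (the shell hypothesis of ✓ `sum_box_le_of_shell_decay` for `k y := |G̃_L(πy + eᵢ) − G̃_L(πy)|`, `1 ≤ r`, `2r < L`).
* §3 ★★ `sum_box_abs_torusGreen_grad_le` (`2R < L ⇒ Σ_{y ∈ Q_R(0) ⊂ ℤ³}|G̃_L(πy+eᵢ) − G̃_L(πy)| ≤ C₁ + 54·C_N·R`) and ★★★ `sum_ball_abs_torusGreen_grad_le`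
  (`∃ C, ∀ L i R, 2R < L → Σ_{z : ∀μ |z̃_μ| ≤ R} |G̃_L(z+eᵢ) − G̃_L(z)| ≤ C·(R + 1)`).
* §4 ★★ `sum_ball_norm_LapSinv_grad_le` — `∃ C, ∀ L i b R, 2R < L → Σ_{z : ∀μ |(b−z)~_μ| ≤ R} ‖LapSinv (fun _ => L) 1 (b+eᵢ) z − LapSinv (fun _ => L) 1 b z‖ ≤ C·(R + 1)`
  (= ★routeR-w3's A2 in B5's `Δ⁻¹` letters; the (A) seat inlines or cites it).
HONEST SCOPE.  Counting + two tree rows; flat torus letters only; the reading on `Site (F.P K) 0` is row (R5) (not here).  `2R < L` is the no-wrap window (the consumer has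
`R = 2ℓ ≪ L_T∕2`).

References: G. F. Lawler, V. Limic, *Random Walk: A Modern Introduction*, CUP 2010, Thm 4.3.1, §6.3 [LawlerLimic2010]; G. F. Lawler, *Intersections of Random Walks* (1991)
Thm 1.5.5; T. Bałaban, CMP 95 (1984) 17–40 [Balaban1984PropagatorsI] ((1.29) p.23); CMP 99 (1985) 75–102 [Balaban1985RegularSpaces] ((1.36) p.82).
-/

set_option autoImplicit false

noncomputable section

open MeasureTheory Set Finset ZMod intervalIntegral
open scoped Real BigOperators

namespace Summit.QuantumFields.YangMills.Theorems.Prop7NearFieldGreenGradientSum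

open Literature.Probability.LatticeModels
open Literature.MathematicalPhysics.QuantumFieldTheory.Balaban1983to89
open B4Eq19LatticeOperators B5LaplaceInverse
open Prop7TorusGreenGradientBricks Prop7TorusGreenGradientDecay Prop7TorusGreenDictionary Prop7NearFieldShellSum

variable {L : ℕ}

/-! ## §1 ★ The gradient of the torus Green function is bounded, uniformly in the period (all `z`, including `z = 0`) -/

/-- ★ **`|G̃_L(z+eᵢ) − G̃_L(z)| ≤ C₁` for ALL `z ∈ (ℤ/Lℤ)³`, uniformly in `L ≥ 1`** (`C₁ = 4K + (π∕4)C₀³`): the heat-kernel part of ✓ `torusGreen_grad_eq` at `S = L²` is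
`≤ ∫₀^{L²} K(1∨s)(((1∨s) + z̃²)³)⁻¹ ds ≤ ∫₀^{L²} K(1∨s)⁻² ds ≤ 4K∫₀^{L²}((s+1)²)⁻¹ds ≤ 4K` (✓ `abs_grad_prod_torusHeatKernel_le` with the Gaussian weight dropped, `2(1∨s) ≥ 1 + s`,
✓ `integral_inv_add_sq_le`), the Fourier tail `≤ (π∕4)C₀³L∕L³ ≤ (π∕4)C₀³` (✓ `abs_torusGreen_grad_tail_le`).  In particular `|G̃_L(eᵢ) − G̃_L(0)| ≤ C₁`, the centre term of the
near-field sum. [folklore] -/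
theorem abs_torusGreen_grad_le : ∃ C₁ : ℝ, 0 ≤ C₁ ∧ ∀ (L : ℕ) [NeZero L] (i : Fin 3) (z : TorusSite 3 L),
    |torusGreen (z + Pi.single i 1) - torusGreen z| ≤ C₁ := by
  obtain ⟨K, hK, hP⟩ := abs_grad_prod_torusHeatKernel_le
  set C₀ : ℝ := ∑' n : ℤ, (1 / 2 : ℝ) ^ n.natAbs with hC₀
  have hC₀0 : 0 ≤ C₀ := tsum_nonneg fun n => by positivity
  refine ⟨4 * K + π / 4 * C₀ ^ 3, by positivity, ?_⟩
  intro L _ i z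
  have hL : (0 : ℝ) < L := by exact_mod_cast Nat.pos_of_ne_zero (NeZero.ne L)
  have hL1 : (1 : ℝ) ≤ L := by exact_mod_cast Nat.one_le_iff_ne_zero.mpr (NeZero.ne L)
  have hS : (0 : ℝ) ≤ (L : ℝ) ^ 2 := by positivity
  rw [torusGreen_grad_eq z i ((L : ℝ) ^ 2)]
  -- heat-kernel part
  have hmain : |∫ s in (0 : ℝ)..(L : ℝ) ^ 2,
      ((∏ μ, torusHeatKernel s ((z + Pi.single i 1 : TorusSite 3 L) μ)) - ∏ μ, torusHeatKernel s (z μ))| ≤ 4 * K := by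
    have hb : ∀ s ∈ Set.Ioc (0 : ℝ) ((L : ℝ) ^ 2),
        |(∏ μ, torusHeatKernel s ((z + Pi.single i 1 : TorusSite 3 L) μ)) - ∏ μ, torusHeatKernel s (z μ)| ≤ 4 * K * ((s + 1) ^ 2)⁻¹ := by
      intro s hs
      refine (hP L s hs.1 hs.2 z i i).trans ?_
      set T : ℝ := max 1 s with hT
      set c : ℝ := ((z i).valMinAbs : ℝ) ^ 2 with hc
      have hc0 : 0 ≤ c := sq_nonneg _
      have hT1 : 1 ≤ T := le_max_left _ _
      have hTs : s ≤ T := le_max_right _ _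
      have hT0 : 0 < T := by positivity
      -- `T·((T+c)³)⁻¹ ≤ T·(T³)⁻¹ = (T²)⁻¹ ≤ 4·((s+1)²)⁻¹`
      have h1 : T * ((T + c) ^ 3)⁻¹ ≤ T * (T ^ 3)⁻¹ := by
        gcongr
        linarith
      have h2 : T * (T ^ 3)⁻¹ = (T ^ 2)⁻¹ := by field_simp
      have h3 : (T ^ 2)⁻¹ ≤ 4 * ((s + 1) ^ 2)⁻¹ := by
        rw [show (4 : ℝ) * ((s + 1) ^ 2)⁻¹ = (((s + 1) / 2) ^ 2)⁻¹ by field_simp; ring]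
        apply inv_anti₀ (by have := hs.1; positivity)
        apply pow_le_pow_left₀ (by have := hs.1; positivity)
        rw [hT, le_max_iff]
        by_cases h1s : s ≤ 1
        · left; linarith
        · right; linarith
      calc K * T * ((T + c) ^ 3)⁻¹ = K * (T * ((T + c) ^ 3)⁻¹) := by ring
        _ ≤ K * (4 * ((s + 1) ^ 2)⁻¹) := mul_le_mul_of_nonneg_left (h1.trans (h2.le.trans h3)) hK.le
        _ = 4 * K * ((s + 1) ^ 2)⁻¹ := by ring
    have hcont : IntervalIntegrable (fun s : ℝ => 4 * K * ((s + 1) ^ 2)⁻¹) volume 0 ((L : ℝ) ^ 2) := by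
      refine ContinuousOn.intervalIntegrable ?_
      rw [Set.uIcc_of_le hS]
      refine continuousOn_const.mul (ContinuousOn.inv₀ ((continuousOn_id.add continuousOn_const).pow 2) fun s hs => ?_)
      have : 0 < s + 1 := by have := hs.1; positivity
      positivity
    calc _ ≤ ∫ s in (0 : ℝ)..(L : ℝ) ^ 2, 4 * K * ((s + 1) ^ 2)⁻¹ := by
          have h := intervalIntegral.norm_integral_le_of_norm_le hS
            (Filter.Eventually.of_forall fun s hs => (Real.norm_eq_abs _).le.trans (hb s hs)) hcont
          rwa [Real.norm_eq_abs] at h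
      _ = 4 * K * ∫ s in (0 : ℝ)..(L : ℝ) ^ 2, ((s + 1) ^ 2)⁻¹ := intervalIntegral.integral_const_mul _ _
      _ ≤ 4 * K * (1 : ℝ)⁻¹ := by
          gcongr
          exact integral_inv_add_sq_le one_pos hS
      _ = 4 * K := by simp
  -- Fourier tail
  have htail := abs_torusGreen_grad_tail_le z i
  rw [← hC₀] at htail
  have hL3 : π / 4 * C₀ ^ 3 * L / (L : ℝ) ^ 3 ≤ π / 4 * C₀ ^ 3 := by
    rw [show π / 4 * C₀ ^ 3 * L / (L : ℝ) ^ 3 = π / 4 * C₀ ^ 3 * ((L : ℝ) ^ 2)⁻¹ by field_simp]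
    apply mul_le_of_le_one_right (by positivity)
    apply inv_le_one_of_one_le₀
    nlinarith
  exact (abs_add_le _ _).trans (add_le_add hmain (htail.trans hL3))

/-! ## §2 The window `ℤ³ → (ℤ/Lℤ)³` on a sup-shell of radius `r < L∕2` -/

/-- **No wrap-around below half the period**: if `2|n| < L` then the centred representative of `n mod L` is `n`. [folklore] -/
theorem valMinAbs_intCast_of_two_mul_abs_lt [NeZero L] {n : ℤ} (h : 2 * |n| < L) : ((n : ZMod L)).valMinAbs = n := by
  rw [ZMod.valMinAbs_spec]
  refine ⟨rfl, ?_, ?_⟩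
  · have := neg_abs_le n
    linarith
  · have := le_abs_self n
    linarith

/-- **On the sup-shell of radius `r` about `0` some coordinate has modulus `r`, so `r² ≤ Σ_μ y_μ²`.** [folklore] -/
theorem sq_le_sum_sq_of_mem_shell {d : ℕ} {r : ℤ} {y : Zd d} (hy : y ∈ (box 0 r) \ (box 0 (r - 1))) :
    ((r : ℝ)) ^ 2 ≤ ∑ μ, ((y μ : ℤ) : ℝ) ^ 2 := by
  rw [Finset.mem_sdiff, B4Eq19LatticeOperators.mem_box, B4Eq19LatticeOperators.mem_box] at hy
  obtain ⟨hin, hout⟩ := hy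
  push Not at hout
  obtain ⟨μ, hμ⟩ := hout
  have h1 : |y μ| ≤ r := by simpa using hin μ
  have h2 : r - 1 < |y μ| := by simpa using hμ
  have h3 : |y μ| = r := le_antisymm h1 (by linarith)
  have h4 : ((r : ℝ)) ^ 2 = ((y μ : ℤ) : ℝ) ^ 2 := by
    rw [← sq_abs ((y μ : ℤ) : ℝ), ← Int.cast_abs, h3]
  rw [h4]
  exact Finset.single_le_sum (f := fun k => ((y k : ℤ) : ℝ) ^ 2) (fun k _ => sq_nonneg _) (Finset.mem_univ μ)

/-- **The shell hypothesis of ✓ `sum_box_le_of_shell_decay` for the windowed gradient**: with `C_N` the constant of ✓ `torusGreen_grad_mul_dist_sq_le`, for `1 ≤ r`, `2r < L` and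
`y` on the sup-shell `Q_r(0) ∖ Q_{r−1}(0) ⊂ ℤ³`, the torus point `πy = (y_μ mod L)_μ` has `z̃ = y` (no wrap), `πy ≠ 0`, `Σ_μ z̃_μ² ≥ r²`, hence
`|G̃_L(πy + eᵢ) − G̃_L(πy)| ≤ C_N∕r²`. [folklore] -/
theorem abs_grad_window_le_of_mem_shell [NeZero L] {C : ℝ}
    (hC : ∀ (i : Fin 3) (z : TorusSite 3 L), z ≠ 0 →
      |torusGreen (z + Pi.single i 1) - torusGreen z| * (∑ k, (((z k).valMinAbs : ℤ) : ℝ) ^ 2) ≤ C)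
    (i : Fin 3) {r : ℤ} (hr : 1 ≤ r) (hrL : 2 * r < L) {y : Zd 3} (hy : y ∈ (box 0 r) \ (box 0 (r - 1))) :
    |torusGreen ((fun μ => ((y μ : ℤ) : ZMod L)) + Pi.single i 1) - torusGreen (fun μ => ((y μ : ℤ) : ZMod L))| ≤ C / (r : ℝ) ^ (3 - 1) := by
  set z : TorusSite 3 L := fun μ => ((y μ : ℤ) : ZMod L) with hz
  have hin : ∀ μ, |y μ| ≤ r := fun μ => by
    have := (Finset.mem_sdiff.1 hy).1
    rw [B4Eq19LatticeOperators.mem_box] at this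
    simpa using this μ
  -- no wrap: `z̃ = y`
  have hval : ∀ μ, (z μ).valMinAbs = y μ := fun μ =>
    valMinAbs_intCast_of_two_mul_abs_lt (by have := hin μ; linarith)
  have hsq : ((r : ℝ)) ^ 2 ≤ ∑ k, (((z k).valMinAbs : ℤ) : ℝ) ^ 2 := by
    simp_rw [hval]
    exact sq_le_sum_sq_of_mem_shell hy
  have hr0 : (0 : ℝ) < r := by exact_mod_cast (show (0 : ℤ) < r by linarith)
  have hr2 : (0 : ℝ) < (r : ℝ) ^ 2 := by positivity
  have hz0 : z ≠ 0 := by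
    intro h
    have : ∑ k, (((z k).valMinAbs : ℤ) : ℝ) ^ 2 = 0 := by simp [h]
    linarith
  have h := hC i z hz0
  have hsum0 : 0 < ∑ k, (((z k).valMinAbs : ℤ) : ℝ) ^ 2 := lt_of_lt_of_le hr2 hsq
  rw [show (3 - 1 : ℕ) = 2 by norm_num, le_div_iff₀ hr2]
  calc |torusGreen (z + Pi.single i 1) - torusGreen z| * (r : ℝ) ^ 2
      ≤ |torusGreen (z + Pi.single i 1) - torusGreen z| * ∑ k, (((z k).valMinAbs : ℤ) : ℝ) ^ 2 :=
        mul_le_mul_of_nonneg_left hsq (abs_nonneg _)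
    _ ≤ C := h

/-! ## §3 ★★★ The near-field sum over a sup-norm ball -/

/-- ★★ **Box form**: with `C₁` of ✓ `abs_torusGreen_grad_le` and `C_N` of ✓ `torusGreen_grad_mul_dist_sq_le`: for `2R < L`,
`Σ_{y ∈ Q_R(0) ⊂ ℤ³} |G̃_L(πy + eᵢ) − G̃_L(πy)| ≤ C₁ + 54·C_N·R` (`2·3·3² = 54`; ✓ `sum_box_le_of_shell_decay`). [folklore] -/
theorem sum_box_abs_torusGreen_grad_le : ∃ C₁ C_N : ℝ, 0 ≤ C₁ ∧ 0 ≤ C_N ∧ ∀ (L : ℕ) [NeZero L] (i : Fin 3) (R : ℕ), 2 * (R : ℤ) < L →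
    ∑ y ∈ box (0 : Zd 3) R, |torusGreen ((fun μ => ((y μ : ℤ) : ZMod L)) + Pi.single i 1) - torusGreen (fun μ => ((y μ : ℤ) : ZMod L))|
      ≤ C₁ + 2 * (3 : ℕ) * 3 ^ (3 - 1) * C_N * R := by
  obtain ⟨C₁, hC₁, h₁⟩ := abs_torusGreen_grad_le
  obtain ⟨C, hC⟩ := torusGreen_grad_mul_dist_sq_le
  -- `C_N := max C 0 ≥ 0` still bounds
  have hC' : ∀ (L : ℕ) [NeZero L] (i : Fin 3) (z : TorusSite 3 L), z ≠ 0 →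
      |torusGreen (z + Pi.single i 1) - torusGreen z| * (∑ k, (((z k).valMinAbs : ℤ) : ℝ) ^ 2) ≤ max C 0 :=
    fun L _ i z hz => (hC L i z hz).trans (le_max_left _ _)
  refine ⟨C₁, max C 0, hC₁, le_max_right _ _, ?_⟩
  intro L _ i R hRL
  set k : Zd 3 → ℝ := fun y =>
    |torusGreen ((fun μ => ((y μ : ℤ) : ZMod L)) + Pi.single i 1) - torusGreen (fun μ => ((y μ : ℤ) : ZMod L))| with hk
  have hkabs : ∀ y, |k y| = k y := fun y => abs_of_nonneg (abs_nonneg _)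
  have hshell : ∀ r : ℤ, 1 ≤ r → r ≤ R → ∀ y ∈ (box (0 : Zd 3) r) \ (box 0 (r - 1)), |k y| ≤ max C 0 / (r : ℝ) ^ (3 - 1) := by
    intro r hr hrR y hy
    rw [hkabs]
    exact abs_grad_window_le_of_mem_shell (hC' L) i hr (by linarith) hy
  have h := sum_box_le_of_shell_decay (d := 3) (by norm_num) (0 : Zd 3) k (le_max_right _ _) R hshell
  simp_rw [hkabs] at h
  have h0 : k 0 ≤ C₁ := by
    rw [hk]
    simpa using h₁ L i (fun _ => ((0 : ℤ) : ZMod L))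
  calc ∑ y ∈ box (0 : Zd 3) R, k y ≤ k 0 + 2 * (3 : ℕ) * 3 ^ (3 - 1) * max C 0 * R := h
    _ ≤ C₁ + 2 * (3 : ℕ) * 3 ^ (3 - 1) * max C 0 * R := by gcongr

/-- ★★★ **THE NEAR-FIELD SUM (row (R4) = A2 of LOCATE #53 §8)**: there is an absolute constant `C` such that for every `L ≥ 1`, every direction `i` and every radius `R` with
`2R < L`,  `Σ_{z ∈ (ℤ/Lℤ)³ : ∀μ |z̃_μ| ≤ R} |G̃_L(z+eᵢ) − G̃_L(z)| ≤ C·(R + 1)`  — the `Σ_{r≤R} r²·r⁻² ≍ R` count behind `c_I·ℓ` (LOCATE #53 §2 (near)).  Proof: with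
`cen z := (z̃_μ)_μ ∈ Q_R(0) ⊂ ℤ³` (injective, `wnd (cen z) = z`) the torus sum is a sub-sum of the box form. [folklore] -/
theorem sum_ball_abs_torusGreen_grad_le : ∃ C : ℝ, 0 ≤ C ∧ ∀ (L : ℕ) [NeZero L] (i : Fin 3) (R : ℕ), 2 * (R : ℤ) < L →
    ∑ z ∈ (Finset.univ : Finset (TorusSite 3 L)).filter (fun z => ∀ μ, (z μ).valMinAbs.natAbs ≤ R),
      |torusGreen (z + Pi.single i 1) - torusGreen z| ≤ C * ((R : ℝ) + 1) := by
  classical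
  obtain ⟨C₁, C_N, hC₁, hCN, h⟩ := sum_box_abs_torusGreen_grad_le
  refine ⟨C₁ + 2 * (3 : ℕ) * 3 ^ (3 - 1) * C_N, by positivity, ?_⟩
  intro L _ i R hRL
  set B : Finset (TorusSite 3 L) := Finset.univ.filter (fun z => ∀ μ, (z μ).valMinAbs.natAbs ≤ R) with hB
  set g : TorusSite 3 L → ℝ := fun z => |torusGreen (z + Pi.single i 1) - torusGreen z| with hg
  set wnd : Zd 3 → TorusSite 3 L := fun y μ => ((y μ : ℤ) : ZMod L) with hwnd
  set cen : TorusSite 3 L → Zd 3 := fun z μ => (z μ).valMinAbs with hcen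
  have hwc : ∀ z, wnd (cen z) = z := fun z => by
    funext μ
    simp [hwnd, hcen, ZMod.coe_valMinAbs]
  have hcen_inj : Function.Injective cen := fun z z' hzz => by
    rw [← hwc z, ← hwc z', hzz]
  have hcenB : B.image cen ⊆ box (0 : Zd 3) R := by
    intro y hy
    obtain ⟨z, hz, rfl⟩ := Finset.mem_image.1 hy
    rw [hB, Finset.mem_filter] at hz
    rw [B4Eq19LatticeOperators.mem_box]
    intro μ
    have := hz.2 μ
    simp only [hcen, Pi.zero_apply, sub_zero]
    rw [← Int.natCast_natAbs]
    exact_mod_cast this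
  -- the torus sum as a sub-sum of the box sum
  have e1 : ∑ z ∈ B, g z = ∑ y ∈ B.image cen, g (wnd y) := by
    rw [Finset.sum_image fun z _ z' _ hzz => hcen_inj hzz]
    exact Finset.sum_congr rfl fun z _ => by rw [hwc]
  have e2 : ∑ y ∈ B.image cen, g (wnd y) ≤ ∑ y ∈ box (0 : Zd 3) R, g (wnd y) :=
    Finset.sum_le_sum_of_subset_of_nonneg hcenB fun y _ _ => abs_nonneg _
  have e3 := h L i R hRL
  calc ∑ z ∈ B, g z ≤ ∑ y ∈ box (0 : Zd 3) R, g (wnd y) := e1.le.trans e2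
    _ ≤ C₁ + 2 * (3 : ℕ) * 3 ^ (3 - 1) * C_N * R := e3
    _ ≤ (C₁ + 2 * (3 : ℕ) * 3 ^ (3 - 1) * C_N) * ((R : ℝ) + 1) := by
        have hR : (0 : ℝ) ≤ R := Nat.cast_nonneg R
        have h1 : C₁ ≤ C₁ * ((R : ℝ) + 1) := le_mul_of_one_le_right hC₁ (by linarith)
        have h2 : 2 * (3 : ℕ) * 3 ^ (3 - 1) * C_N * R ≤ 2 * (3 : ℕ) * 3 ^ (3 - 1) * C_N * ((R : ℝ) + 1) := by
          gcongr; linarith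
        linarith [h1, h2]

/-! ## §4 ★★ The two-point form in B5's `Δ⁻¹` letters -/

/-- ★★ **A2 in B5's letters** (★routeR-w3 g5 19:28:35Z): there is an absolute constant `C` such that for every `L ≥ 1`, direction `i`, centre `b ∈ (ℤ/Lℤ)³` and radius `R` with
`2R < L`,  `Σ_{z : ∀μ |(b − z)~_μ| ≤ R} ‖LapSinv (fun _ => L) 1 (b + eᵢ) z − LapSinv (fun _ => L) 1 b z‖ ≤ C·(R + 1)`  — by ✓ `LapSinv_one_apply_eq_half_torusGreen`
(`Δ⁻¹(x,z) = ½G̃_L(x − z)`), `(b + eᵢ) − z = (b − z) + eᵢ`, and the reindexing `z ↦ b − z` onto ✓ `sum_ball_abs_torusGreen_grad_le`. [folklore] -/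
theorem sum_ball_norm_LapSinv_grad_le : ∃ C : ℝ, 0 ≤ C ∧ ∀ (L : ℕ) [NeZero L] (i : Fin 3) (b : TorusSite 3 L) (R : ℕ), 2 * (R : ℤ) < L →
    ∑ z ∈ (Finset.univ : Finset (TorusSite 3 L)).filter (fun z => ∀ μ, ((b - z) μ).valMinAbs.natAbs ≤ R),
      ‖LapSinv (fun _ : Fin 3 => L) (1 : ℂ) (b + Pi.single i 1) z - LapSinv (fun _ : Fin 3 => L) (1 : ℂ) b z‖ ≤ C * ((R : ℝ) + 1) := by
  classical
  obtain ⟨C, hC, h⟩ := sum_ball_abs_torusGreen_grad_le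
  refine ⟨C / 2, by positivity, ?_⟩
  intro L _ i b R hRL
  -- the summand in Green-function letters
  have hterm : ∀ z : TorusSite 3 L,
      ‖LapSinv (fun _ : Fin 3 => L) (1 : ℂ) (b + Pi.single i 1) z - LapSinv (fun _ : Fin 3 => L) (1 : ℂ) b z‖
        = |torusGreen ((b - z) + Pi.single i 1) - torusGreen (b - z)| / 2 := by
    intro z
    rw [LapSinv_one_apply_eq_half_torusGreen, LapSinv_one_apply_eq_half_torusGreen, ← Complex.ofReal_sub, Complex.norm_real,
      Real.norm_eq_abs, show b + Pi.single i 1 - z = b - z + Pi.single i 1 by abel, ← sub_div, abs_div, abs_two]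
  simp_rw [hterm]
  rw [← Finset.sum_div, div_le_iff₀ (by norm_num : (0 : ℝ) < 2)]
  -- reindex `z ↦ b − z`
  have e : ∑ z ∈ (Finset.univ : Finset (TorusSite 3 L)).filter (fun z => ∀ μ, ((b - z) μ).valMinAbs.natAbs ≤ R),
        |torusGreen ((b - z) + Pi.single i 1) - torusGreen (b - z)|
      = ∑ u ∈ (Finset.univ : Finset (TorusSite 3 L)).filter (fun u => ∀ μ, (u μ).valMinAbs.natAbs ≤ R),
        |torusGreen (u + Pi.single i 1) - torusGreen u| := by
    rw [Finset.sum_filter, Finset.sum_filter]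
    exact Fintype.sum_equiv (Equiv.subLeft b) _ _ fun z => by simp [Equiv.subLeft]
  rw [e]
  calc _ ≤ C * ((R : ℝ) + 1) := h L i R hRL
    _ = C / 2 * ((R : ℝ) + 1) * 2 := by ring

end Summit.QuantumFields.YangMills.Theorems.Prop7NearFieldGreenGradientSum
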